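/-
Copyright (c) 2026. All rights reserved.
Released under Apache 2.0 license as described in the file LICENSE.
Authors: abc-iut cell, wave-5 prover seat abc-iut-w5-d009 (gen 4).
-/
import Literature.NumberTheory.DiophantineGeometry.GenEllNorthcott
import Literature.NumberTheory.DiophantineGeometry.GenEllAnnulus
import Literature.NumberTheory.DiophantineGeometry.GenEllFullGalois
import Literature.NumberTheory.DiophantineGeometry.GenEllProjLineExamples
import Literature.NumberTheory.DiophantineGeometry.GenEllPullbackConductor
import Literature.NumberTheory.DiophantineGeometry.GenEllLCyclic
import Literature.NumberTheory.DiophantineGeometry.GenEllRemarks44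
import HarnessLib

/-!
# Kernel closure census of the [GenEll] vocabulary PREDICATES of the frozen fact list

Mochizuki, *Arithmetic elliptic curves in general position*, Math. J. Okayama Univ. 52 (2010)
(`MochizukiGenEll2010`), §1 (points of `U_P = ℙ¹ ∖ {0,1,∞}` over number fields, compactly bounded
subsets, Ex. 1.3), §2 (Thm. 2.1 (ii): "far from the cusps"), Prop. 1.7 (pull-back of points under a
finite map `φ : ℙ¹ → ℙ¹`), §3 (`M_ell`, Lemma 3.5: `l`-cyclic subgroup schemes).

PROOF-ONLY file (no new definitions).  Several declarations of the cell's [GenEll] vocabulary are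
`Prop`-valued **predicates with free parameters** — membership / position / hypothesis predicates,
not published theorems — yet they sit in the frozen fact list of the cell (plan/FACT-LIST.md rows
F-1332 `IsGaloisFinite`, F-2739 `NFPoint.FarFromCusps`, F-2741 `MellCBData.Mem`, F-2754
`EllPoint.AdmitsLCyclic`, F-2762 `NFPoint.InU`, F-2763 `CBData.Mem`, F-2764 `CBData.SupportContains`,
F-2765 `NFPoint.MapsUnder`) and were handed to fact-PROVING seats (plan/F-TRANCHES.tsv, tranches
6, 179–181).  This file records, in the kernel, what there is to know about each of them:

* the UNIVERSAL CLOSURE is FALSE (an explicit counter-instance: a `ℚ`-point, the standard compactly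
  bounded subset `CBData.std`, the finite map with zero denominator, …), so the row is not a theorem
  to prove and not an assumption to bind unapplied; and
* the predicate is INHABITED (an explicit instance), so consumers that take it as a hypothesis are
  not vacuous.

Nothing here is deep; every proof is a few lines over the landed vocabulary files.  Classical;
no bearing on, and no side taken on, [IUTchIII] Cor. 3.12.  `typed ≠ proved`; a fact-list row is an
assumption label, not an endorsement.
-/

noncomputable section

open Polynomial Metric Set

namespace Literature.NumberTheory.DiophantineGeometry.GenEll

/-! ## `NFPoint.InU` (F-2762) — "the point lies in `U_P = ℙ¹ ∖ {0,1,∞}`" -/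

/-- The `ℚ`-point `λ = 0` is a cusp: `¬ InU`. [cite: MochizukiGenEll2010, Thm 2.1 (ii) p.11] -/
theorem not_inU_ratPoint_zero : ¬ (ratPoint 0).InU := fun h => h.1 rfl

/-- F-2762 is a PREDICATE: its universal closure is false (witness `λ = 0 ∈ ℙ¹(ℚ)`).
[cite: MochizukiGenEll2010, Thm 2.1 (ii) p.11] -/
theorem not_forall_inU : ¬ ∀ P : NFPoint, P.InU := fun h => not_inU_ratPoint_zero (h _)

/-- … and it is inhabited: `λ = 1/2 ∈ U_P(ℚ)`. [cite: MochizukiGenEll2010, Thm 2.1 (ii) p.11] -/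
theorem inU_ratPoint_half : (ratPoint 2⁻¹).InU :=
  (ratPoint_mem_UPle_one (by norm_num) (by norm_num)).1.1

/-! ## `CBData.Mem` (F-2763) — membership `x ∈ K_V` in a compactly bounded subset -/

/-- F-2763 is a PREDICATE: its universal closure is false — the cusp `λ = 0` lies in no compactly
bounded subset of `U_P` (here: not in the standard one with support `{∞}`), since members lie in
`U_P` (`CBData.inU_of_mem`). [cite: MochizukiGenEll2010, Ex 1.3 (ii) p.6] -/
theorem not_forall_cbData_mem : ¬ ∀ (D : CBData) (P : NFPoint), D.Mem P := fun h =>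
  not_inU_ratPoint_zero (CBData.inU_of_mem (h (CBData.std ∅ (by simp)) (ratPoint 0)))

/-- … and it is inhabited: `1/2 ∈ K_V` for the standard compactly bounded subset (the tree's
`CBData.ratPoint_half_mem`). [cite: MochizukiGenEll2010, Ex 1.3 (ii) p.6] -/
theorem exists_cbData_mem : ∃ (D : CBData) (P : NFPoint), D.Mem P :=
  ⟨CBData.std ∅ (by simp), ratPoint 2⁻¹, CBData.ratPoint_half_mem ∅ (by simp)⟩

/-! ## `CBData.SupportContains` (F-2764) — "the support of `K_V` contains `Σ`" -/

/-- F-2764 is a PREDICATE: its universal closure is false — the standard compactly bounded subset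
with support `{∞}` does not have `2` in its support. [cite: MochizukiGenEll2010, Thm 2.1 (ii) p.11] -/
theorem not_forall_supportContains : ¬ ∀ (D : CBData) (S : Finset ℕ), D.SupportContains S := by
  intro h
  have h2 : ({2} : Finset ℕ) ⊆ (CBData.std ∅ (by simp)).primes := h _ _
  have h2' : (2 : ℕ) ∈ (∅ : Finset ℕ) := h2 (Finset.mem_singleton_self 2)
  simp at h2'

/-- … and it is inhabited (the tree's `CBData.exists_cbData_supportContains`, restated pointwise):
every finite set of primes is the nonarchimedean support of some compactly bounded subset.
[cite: MochizukiGenEll2010, Ex 1.3 (ii) p.5] -/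
theorem supportContains_std (S : Finset ℕ) (hS : ∀ p ∈ S, p.Prime) :
    (CBData.std S hS).SupportContains S := subset_rfl

/-! ## `NFPoint.FarFromCusps` (F-2739) — "`x` is `ρ`-far from the cusps at `∞` and at `S`" -/

/-- F-2739 is a PREDICATE: its universal closure is false — for `ρ = 2` the archimedean condition
`ρ < |σ(x)| < ρ⁻¹` is unsatisfiable (at any point; here `λ = 1/2`).
[cite: MochizukiGenEll2010, Thm 2.1 p.12] -/
theorem not_forall_farFromCusps :
    ¬ ∀ (S : Finset ℕ) (ρ : ℝ) (P : NFPoint), P.FarFromCusps S ρ := by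
  intro h
  obtain ⟨σ⟩ : Nonempty ((ratPoint 2⁻¹).F →+* ℂ) := inferInstance
  obtain ⟨h1, h2, -⟩ := (h ∅ 2 (ratPoint 2⁻¹)).1 σ
  have h3 : (2 : ℝ)⁻¹ < 2 := by norm_num
  linarith

/-- … and it is inhabited: `λ = 1/2` is `1/4`-far from the cusps at `∞` (and, vacuously, at the empty
set of primes): every complex embedding sends `1/2` to `1/2`, of absolute value `1/2 ∈ (1/4, 4)` and at
distance `1/2 > 1/4` from `1`. [cite: MochizukiGenEll2010, Thm 2.1 p.12] -/
theorem farFromCusps_ratPoint_half : (ratPoint 2⁻¹).FarFromCusps ∅ 4⁻¹ := by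
  refine ⟨fun σ => ?_, fun p hp => by simp at hp⟩
  have hx : σ (ratPoint (2⁻¹ : ℚ)).x = (2 : ℂ)⁻¹ := by
    rw [show (ratPoint (2⁻¹ : ℚ)).x = (2 : (ratPoint (2⁻¹ : ℚ)).F)⁻¹ from rfl, map_inv₀, map_ofNat]
  have hn : ‖(2 : ℂ)⁻¹‖ = 2⁻¹ := by simp
  have hn1 : ‖(2 : ℂ)⁻¹ - 1‖ = 2⁻¹ := by
    rw [show (2 : ℂ)⁻¹ - 1 = -(2 : ℂ)⁻¹ by norm_num, norm_neg, hn]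
  rw [hx, hn, hn1]
  norm_num

/-! ## `IsGaloisFinite` (F-1332) — "`E ⊆ X(Q̄)` is Galois-finite" ([GenEll] Ex. 1.3 (i)) -/

/-- The minimal polynomial of the `ℚ`-point `q` is `X − q`. [cite: MochizukiGenEll2010, Ex 1.3 (i) p.5] -/
theorem mpoly_ratPoint (q : ℚ) : (ratPoint q).mpoly = X - C q := minpoly.eq_X_sub_C' q

/-- The whole of `U_P(Q̄)` is NOT Galois-finite: already `U_P(Q̄)^{≤ 1} ⊇ {2, 3, 4, …} ⊆ ℙ¹(ℚ)` has
infinitely many minimal polynomials `X − n`. [cite: MochizukiGenEll2010, Ex 1.3 (i) p.5] -/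
theorem not_isGaloisFinite_univ : ¬ IsGaloisFinite (Set.univ : Set NFPoint) := by
  intro h
  have hfin : (NFPoint.mpoly '' (Set.univ ∩ UPle 1)).Finite := h 1
  have hsub : Set.range (fun n : ℕ => (X - C ((n : ℚ) + 2) : ℚ[X])) ⊆
      NFPoint.mpoly '' (Set.univ ∩ UPle 1) := by
    rintro _ ⟨n, rfl⟩
    have h0 : (n : ℚ) + 2 ≠ 0 := by positivity
    have h1 : (n : ℚ) + 2 ≠ 1 := by
      have : (1 : ℚ) < n + 2 := by linarith [n.cast_nonneg (α := ℚ)]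
      exact this.ne'
    exact ⟨ratPoint ((n : ℚ) + 2), ⟨Set.mem_univ _, ratPoint_mem_UPle_one h0 h1⟩, mpoly_ratPoint _⟩
  have hinj : Function.Injective (fun n : ℕ => (X - C ((n : ℚ) + 2) : ℚ[X])) := by
    intro m n hmn
    have h0 := congr_arg (fun p : ℚ[X] => p.coeff 0) hmn
    simp only [coeff_sub, coeff_X_zero, coeff_C_zero, zero_sub, neg_inj, add_left_inj,
      Nat.cast_inj] at h0
    exact h0
  exact (Set.infinite_range_of_injective hinj) (hfin.subset hsub)

/-- F-1332 is a PREDICATE: its universal closure is false (witness `E = U_P(Q̄)` itself).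
[cite: MochizukiGenEll2010, Ex 1.3 (i) p.5] -/
theorem not_forall_isGaloisFinite : ¬ ∀ S : Set NFPoint, IsGaloisFinite S :=
  fun h => not_isGaloisFinite_univ (h _)

/-- … and it is inhabited: the empty set is Galois-finite. [cite: MochizukiGenEll2010, Ex 1.3 (i) p.5] -/
theorem isGaloisFinite_empty : IsGaloisFinite (∅ : Set NFPoint) := by
  intro d
  show (NFPoint.mpoly '' (∅ ∩ UPle d)).Finite
  rw [Set.empty_inter, Set.image_empty]
  exact Set.finite_empty

/-! ## `NFPoint.MapsUnder` (F-2765) — "`y ↦ x` under the finite map `φ`" ([GenEll] Prop. 1.7) -/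

/-- F-2765 is a PREDICATE (a `Prop`-valued structure): its universal closure is false — for the
presentation `φ = (X : 0)` with zero denominator no point maps anywhere (`g(y) ≠ 0` fails).
[cite: MochizukiGenEll2010, Prop 1.7 p.9] -/
theorem not_forall_mapsUnder :
    ¬ ∀ (φ : P1FiniteMap) (P Q : NFPoint) (ι : P.F →+* Q.F), NFPoint.MapsUnder φ P Q ι := by
  intro h
  exact (h ⟨X, 0, 1, natDegree_X_le, by simp⟩ (ratPoint 0) (ratPoint 0) (RingHom.id _)).den_ne_zero
    (by simp)

/-- … and it is inhabited: under the identity map `φ = (X : 1)` the point `1/2` maps to itself.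
[cite: MochizukiGenEll2010, Prop 1.7 p.9] -/
theorem mapsUnder_id_ratPoint_half :
    NFPoint.MapsUnder ⟨X, 1, 1, natDegree_X_le, by simp⟩ (ratPoint 2⁻¹) (ratPoint 2⁻¹)
      (RingHom.id _) :=
  ⟨by simp, by simp⟩

/-! ## `EllPoint.AdmitsLCyclic` (F-2754) — "`E_F` admits an `l`-cyclic subgroup scheme" -/

/-- F-2754 is a PREDICATE (the HYPOTHESIS of [GenEll] Lemma 3.5, not its conclusion); it is
inhabited at `l = 1` for every curve (the trivial subgroup is Galois-stable of order `1`).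
[cite: MochizukiGenEll2010, Lem 3.5 p.17] -/
theorem admitsLCyclic_one (P : EllPoint) : P.AdmitsLCyclic 1 :=
  ⟨⊥, fun σ x hx => by rw [(AddSubgroup.mem_bot).1 hx, smul_zero]; exact AddSubgroup.zero_mem _,
    by simp⟩

/-! ## `MellCBData.Mem` (F-2741) — membership `[E] ∈ K_V ⊆ M_ell(Q̄)` -/

/-- F-2741 is a PREDICATE: its universal closure is false.  Counter-instance: the Legendre curve
`E_{1/2}` over `ℚ` and the compactly bounded subset of `M_ell` with support `{∞}` whose archimedean
domain is the closed unit disc around `j(E_{1/2}) + 37` — which misses `σ(j(E_{1/2})) = j(E_{1/2})`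
for the (unique) embedding `σ : ℚ → ℂ`. [cite: MochizukiGenEll2010, Ex 1.3 (ii) p.6] -/
theorem not_forall_mellCBData_mem : ¬ ∀ (D : MellCBData) (P : EllPoint), D.Mem P := by
  intro h
  let P : EllPoint := (ratPoint 2⁻¹).legendre inU_ratPoint_half
  let j : ℚ := P.W.j
  let c : ℂ := (j : ℂ) + 37
  have hc : (starRingEnd ℂ) c = c := by
    simp only [c, map_add, map_ratCast, map_ofNat]
  let D : MellCBData :=
    { primes := ∅
      primes_prime := by simp
      Karc := closedBall c 1
      Knon := fun _ _ => Set.univ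
      Karc_nonempty := ⟨c, mem_closedBall_self zero_le_one⟩
      Karc_isCompact := isCompact_closedBall c 1
      Karc_closure_interior := by
        rw [interior_closedBall c one_ne_zero, closure_ball c one_ne_zero]
      Karc_conj := by
        intro z hz
        rw [mem_closedBall, dist_eq_norm] at hz ⊢
        rw [← hc, ← map_sub, Complex.norm_conj]
        exact hz
      Knon_nonempty := by intro p hp; simp at hp
      Knon_galois := by intro p hp; simp at hp
      Knon_compactDomain := by intro p hp; simp at hp }
  let σ : P.F →+* ℂ := Rat.castHom ℂ
  have hmem : σ P.W.j ∈ closedBall c 1 := (h D P).1 σ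
  have hσ : σ P.W.j = (j : ℂ) := eq_ratCast σ j
  rw [hσ, mem_closedBall, dist_eq_norm] at hmem
  have : ‖(j : ℂ) - c‖ = 37 := by
    simp only [c, sub_add_cancel_left, norm_neg]
    norm_num
  linarith

end Literature.NumberTheory.DiophantineGeometry.GenEll

end
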